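import Mathlib
import Summits.MatrixMultiplication.MatrixMultiplication.Theorems.AbelianSTPPSieve

/-!
# Rule set vP of the abelian STPP census: the arithmetic of rules U11-G / U11-P and the representation-count objects

Definitions only (no theorems), to be landed verbatim by a prover seat as the vocabulary of the candidate route
`Theses/AbelianSTPPCensusVP.lean` (planner gen 6, 2026-08-26; cell mm-stpp; lit POLLARD-KILLS.md v1.2 §§1–2, REF [52]/[73]).

* `pAB`, `pBC`, `pCA` — the pair products `Σ a_i b_i`, `Σ b_i c_i`, `Σ c_i a_i` (= |X|, |Y|, |Z′| of the STPP difference sets);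
* `ubB M a b c t` — the bookkeeping ceiling `Σ a_i c_i · min(t, b_i) + t · (M − P_CA)` for `N_t(X,Y)` ((B3));
* `lB a b c t` — the fibre budget `Σ_{b_i < t} b_i · min(a_i, c_i)`;
* `U11GFormB` / `U11G` — rule U11-G (Grynkiewicz floor vs ceiling, additive form; form B and its two letter rotations);
* `U11PFormB` / `U11P` — rule U11-P (Pollard floor vs ceiling at prime orders; three forms);
* `SieveAdmissibleVP M a b c := SieveAdmissible M a b c ∧ U11G M a b c ∧ (M.Prime → U11P M a b c)`;
* `diffUnion A B = ⋃_j (B_j − A_j)`, `repCount X Y w = r_{X,Y}(w)`, `Nt X Y t = Σ_w min(t, r_{X,Y}(w))`.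
Sanity (planner folder routeVP/SketchVP_sanity.lean, farm rc 0): the typed rules reproduce the reference kills of REF [52] with their numbers
(order 111 {(4,4,4)×3,(3,3,3)}: t = 5, 521 > 489; order 127 (4,4,4)×4: 591 > 571 (U11-G), 615 > 571 (U11-P); (6,6,6)×4 killed at 348, alive at 350).
Landed by mm-stpp-theory gen 4 from the planner file (sha256 87b27a08…) with lint-only edits: `linter.dupNamespace` off (single-conjunct
summit), the unused size list of `pAB`/`pBC`/`pCA` `_`-prefixed (every rule function takes the full shape list `(a, b, c)` so that the
letter rotations are argument rotations), `diffUnion` computable. WHAT THIS IS NOT: no claim — the soundness theorems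
(«`IsSTPP` ⇒ rules») and the certificate replay are separate Theorems files / route items.
-/

-- single-conjunct summit: the mandated namespace repeats `MatrixMultiplication`.
set_option linter.dupNamespace false

namespace Summit.MatrixMultiplication.MatrixMultiplication.Theorems

open Finset
open scoped Pointwise

variable {N : ℕ}

/-! ### The arithmetic of rules U11-G / U11-P (form B = middle letter `b`; forms A, C are the cyclic letter rotations) -/

/-- `P_AB = Σ a_i b_i` (= |X|, X = ⊔ (B_j − A_j)). -/
def pAB (a b _c : Fin N → ℕ) : ℕ := ∑ i, a i * b i
/-- `P_BC = Σ b_i c_i` (= |Y|, Y = ⊔ (C_k − B_k)). -/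
def pBC (_a b c : Fin N → ℕ) : ℕ := ∑ i, b i * c i
/-- `P_CA = Σ c_i a_i` (= |Z′|, Z′ = ⊔ (C_i − A_i)). -/
def pCA (a _b c : Fin N → ℕ) : ℕ := ∑ i, c i * a i
/-- (B3) upper bound `UB_B(t) = Σ a_i c_i · min(t, b_i) + t · (M − P_CA)⁺` for `N_t(X, Y) = Σ_w min(t, r_{X,Y}(w))`. -/
def ubB (M : ℕ) (a b c : Fin N → ℕ) (t : ℕ) : ℕ := (∑ i, a i * c i * min t (b i)) + t * (M - pCA a b c)
/-- Fibre budget `L_B(t) = Σ_{i : b_i < t} b_i · min(a_i, c_i)` (POLLARD-KILLS §2 fibre lemma). -/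
def lB (a b c : Fin N → ℕ) (t : ℕ) : ℕ := ∑ i, if b i < t then b i * min (a i) (c i) else 0

/-- Rule U11-G, form B: for every `t` with `2 ≤ t ≤ min(P_AB, P_BC)` and `t ≤ L_B(t)`, Grynkiewicz's floor is below the ceiling:
`t (P_AB + P_BC) − 2t² + 1 ≤ UB_B(t)` for `t ≥ 3` ([Gry10] Thm 1.1 (6)) and `2 (P_AB + P_BC) − 4 ≤ UB_B(2)` ([Gry10] Thm 1.2 (10)); additive form, no truncation. -/
def U11GFormB (M : ℕ) (a b c : Fin N → ℕ) : Prop :=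
  ∀ t : ℕ, 2 ≤ t → t ≤ pAB a b c → t ≤ pBC a b c → t ≤ lB a b c t →
    (t = 2 → 2 * (pAB a b c + pBC a b c) ≤ ubB M a b c 2 + 4) ∧
    (3 ≤ t → t * (pAB a b c + pBC a b c) + 1 ≤ ubB M a b c t + 2 * t ^ 2)

/-- Rule U11-G, all three letter forms (B; A = letters `(c,a,b)`; C = letters `(b,c,a)`, i.e. the rule applied to the rotated families
`(C,A,B)` and `(B,C,A)`, which are STPP with the family). -/
def U11G (M : ℕ) (a b c : Fin N → ℕ) : Prop :=
  U11GFormB M a b c ∧ U11GFormB M c a b ∧ U11GFormB M b c a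

/-- Rule U11-P, form B (prime order `M = p`, host necessarily `ℤ/p`): Pollard's floor `t · min(p, P_AB + P_BC − t) ≤ UB_B(t)` for every
`1 ≤ t ≤ min(P_AB, P_BC)` ([Pol74] = Nathanson GTM 165 Thm 2.4; kernel `Literature.Combinatorics.Additive.Pollard`, p409392). -/
def U11PFormB (M : ℕ) (a b c : Fin N → ℕ) : Prop :=
  ∀ t : ℕ, 1 ≤ t → t ≤ pAB a b c → t ≤ pBC a b c → t * min M (pAB a b c + pBC a b c - t) ≤ ubB M a b c t

/-- Rule U11-P, all three letter forms. -/
def U11P (M : ℕ) (a b c : Fin N → ℕ) : Prop :=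
  U11PFormB M a b c ∧ U11PFormB M c a b ∧ U11PFormB M b c a

/-- Admissibility under the candidate rule set vP = vM (`SieveAdmissible`) + U11-G + U11-P at prime orders. -/
def SieveAdmissibleVP (M : ℕ) (a b c : Fin N → ℕ) : Prop :=
  SieveAdmissible M a b c ∧ U11G M a b c ∧ (M.Prime → U11P M a b c)

/-! ### Representation bookkeeping objects (B1)–(B3) -/

/-- `X = ⋃_j (B_j − A_j)` as a finset (pointwise difference). -/
def diffUnion {H : Type*} [AddCommGroup H] [DecidableEq H] (A B : Fin N → Finset H) : Finset H :=
  univ.biUnion fun j => B j - A j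

/-- representation count `r_{X,Y}(w) = #{(x,y) ∈ X × Y : x + y = w}`. -/
def repCount {H : Type*} [AddCommGroup H] [DecidableEq H] (X Y : Finset H) (w : H) : ℕ :=
  ((X ×ˢ Y).filter fun p => p.1 + p.2 = w).card

/-- `N_t(X,Y) = Σ_w min(t, r_{X,Y}(w)) = Σ_{i ≤ t} |X +_i Y|`. -/
def Nt {H : Type*} [AddCommGroup H] [Fintype H] [DecidableEq H] (X Y : Finset H) (t : ℕ) : ℕ :=
  ∑ w, min t (repCount X Y w)

end Summit.MatrixMultiplication.MatrixMultiplication.Theorems
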